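/-
Copyright (c) 2026 the pub-hodgecm-mathlib formalisation cell (harness21).  Prover seat hodgecm-mathlib-A-p19 (g25): T3′ P-1 row (ii) helper 2 «THE FRAME AT w»
(road «S3-tree», crux H413).
-/
import Literature.NumberTheory.Rogawski1990.DepthZeroKappaTransferTypeOneUnitRow     -- ★ p846155 O8d-1u (F0P3b-p01): the literal package currency, ★ O8d-0 frames
import Literature.NumberTheory.Automorphic.SplitTorusOrderFixedSidePlace            -- ★ p846221 Σ2-CM (this seat): the inert dictionary at a place
import Literature.NumberTheory.Automorphic.SplitTorusOrderStratumParity              -- ★ p846292 helper 1 (this seat) (⇒ ★ O8a-∃ `exists_norm_solution_of_zpow_even`)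
import Literature.NumberTheory.Automorphic.AnisotropicUnitaryGroupCompactOfPlace    -- ★ `conjLocal_apply_eq_of_smul_eq`
import Literature.NumberTheory.Automorphic.UnitaryConjClassClosed                   -- ★ `formCongr_mul`
import Literature.NumberTheory.Automorphic.SelfDualLatticeCountFrameTransportCM     -- ★ `valued_toPlace_uniformizer`, `galAdicCompletionMap_toPlace_self`
import Literature.NumberTheory.Rogawski1990.RankOneUnstableDeltaSymbolTorusCoordinates -- ★ `conjLocal_apply_eq_galAdicCompletionMap`, `galAdicCompletionMap_apply_mul_self_of_conjLocal`
import HarnessLib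

/-!
# The depth-zero κ-transfer, type (1): ROW 2 — the frame of a Flicker literal read at the place `w`

Topic `NumberTheory/Rogawski1990`; namespace `Literature.NumberTheory.Rogawski1990`.  THEOREMS ONLY (no definition, no instance, no notation, no named
fact, no `sorry`); kernel lane `--supports stmt-HodgeConjecture-24833` (road «S3-tree», T3′ «DEPTH-ZERO κ-TRANSFER», P-1 row (ii), helper 2∕2).

The plumbing from the literal package of ★ `DepthZeroKappaTransferTypeOneUnitRow` (elements of `L ⊗ L⁺_v = Π_{w′ ∣ v} L_{w′}`, the congruence `ψ g = Tl g Tl⁻¹`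
onto `U(Φ₃)`, Flicker's literal `t_π(x₁,x₂,x₃)`) to the one-place currency of ★ O8a-4 ∕ ★ `SplitTorusOrderStratumParity` at the non-split place `w`:
* §1 reading at `w` (★ `conjLocal_apply_eq_galAdicCompletionMap`, ★ `galAdicCompletionMap_apply_mul_self_of_conjLocal`): `valuation_eq_one_of_map_mul_self_eq_one`, the `Valued`∕`valuation` bridges
  `valuation_eq_valuation_pow_of_valued_eq`, `valuation_eq_valuation_zpow_of_valued_eq`;
* §2 **`odd_log_valued_of_forall_conjLocal_mul_ne`** — Flicker's non-norm `π` (`π ≠ z̄z`) has ODD order at an inert `w` (★ O8a-∃ + ★ Σ2-CM);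
* §3 the explicit eigenframes `Q = Tl⁻¹(D_π h)` ∕ `Tl⁻¹ h` of `t` (`exists_framePi_of_congr`, `exists_frameOne_of_congr`), their Gram matrices
  `diag(−2π, 1, 2π)` ∕ `diag(−2, 1, 2)` for the ISOMETRY `Tl` (`formCongr_framePi_eq`, `formCongr_frameOne_eq`, ★ `gram_flickerFrame{_pi,}`), `formCongr` read
  at `w` (`formCongr_map_evalRingHom`);
* §4 `valuation_mul_map_mul_valuation_zpow_odd_ne_one` (odd powers of a uniformizer are not norm values: the `hϖodd` input of ★
  `ncard_setOf_selfDual_cyclic_eq_zero_of_odd`), `one_le_of_valued_sub_eq_exp` (deep differences have positive order).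

HONEST LABEL: HC_CM is proved only modulo the 2 remaining named inputs (hLiu418 24832, h413 24833) until rung 0 closes; this file is count-neutral.

## References
* [Flicker1998UnitaryFL] Y. Z. Flicker, *Elementary proof of the fundamental lemma for a unitary group*, Canad. J. Math. 50 (1998), §2 Prop. 3 p. 78.
* [Serre1979] J.-P. Serre, *Local Fields*, GTM 67 (1979), Ch. II §1, Ch. V §2 Prop. 3.
* [PlatonovRapinchuk1994] V. Platonov, A. Rapinchuk, *Algebraic Groups and Number Theory* (1994), §5.1 (completions of a global form).
* [Rogawski1990] J. D. Rogawski, *Automorphic Representations of Unitary Groups in Three Variables* (1990), §4.9 p. 54–56.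
-/

set_option autoImplicit false

noncomputable section

open NumberField IsDedekindDomain Matrix Polynomial Finset
open Literature.NumberTheory.Automorphic Literature.NumberTheory.Automorphic.UnitaryGroup
open Literature.NumberTheory.GaloisRepresentations
open scoped Matrix MatrixGroups ValuativeRel

namespace Literature.NumberTheory.Rogawski1990

section PlacePlumbing

variable (L : Type) [Field L] [NumberField L] [IsCMField L] {v : HeightOneSpectrum (𝓞 ↥(maximalRealSubfield L))}
  (w : PlacesOver L v) (hw : IsCMField.complexConj L • w.1 = w.1)

/-- Norm-one elements of `L_w` have valuation `1` (`|σ_w a| = |a|`). [cite: Serre1979, Ch. II §1] -/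
theorem valuation_eq_one_of_map_mul_self_eq_one {a : w.1.adicCompletion L}
    (ha : galAdicCompletionMap (L := L) (IsCMField.complexConj L) hw a * a = 1) :
    ValuativeRel.valuation (w.1.adicCompletion L) a = 1 := by
  have h := congrArg (ValuativeRel.valuation (w.1.adicCompletion L)) ha
  rw [map_mul, map_one, valuation_galAdicCompletionMap_eq (IsCMField.complexConj L) v w hw, ← sq] at h
  exact (pow_eq_one_iff.1 h).resolve_right two_ne_zero

omit [IsCMField L] in
/-- The `Valued`∕`valuation` bridge for orders: `|x| = exp(−m)`, `|ϖ| = exp(−1)` ⇒ `valuation x = valuation ϖ ^ m` (the `hN` shape of ★ O1∕O8a-5Σ). [cite: Serre1979, Ch. II §1] -/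
theorem valuation_eq_valuation_pow_of_valued_eq {x ϖ : w.1.adicCompletion L} (hϖ : Valued.v ϖ = WithZero.exp (-1 : ℤ)) {m : ℕ}
    (hx : Valued.v x = WithZero.exp (-(m : ℤ))) :
    ValuativeRel.valuation (w.1.adicCompletion L) x = ValuativeRel.valuation (w.1.adicCompletion L) ϖ ^ m := by
  rw [← map_pow, ← v_eq_iff_valuation_eq, hx, map_pow, hϖ, ← WithZero.exp_nsmul]
  congr 1; simp

omit [IsCMField L] in
/-- The same bridge for integer exponents: `|x| = exp(−m)` ⇒ `valuation x = valuation (ϖ ^ m)`, `m : ℤ` (the shape of ★ O8a-∃'s norm solutions). [cite: Serre1979, Ch. II §1] -/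
theorem valuation_eq_valuation_zpow_of_valued_eq {x ϖ : w.1.adicCompletion L} (hϖ : Valued.v ϖ = WithZero.exp (-1 : ℤ)) {m : ℤ}
    (hx : Valued.v x = WithZero.exp (-m)) :
    ValuativeRel.valuation (w.1.adicCompletion L) x = ValuativeRel.valuation (w.1.adicCompletion L) (ϖ ^ m) := by
  have hϖ0 : ϖ ≠ 0 := by intro h; rw [h, map_zero] at hϖ; exact WithZero.zero_ne_coe hϖ
  rw [← v_eq_iff_valuation_eq, hx, map_zpow₀, hϖ, ← WithZero.exp_zsmul]
  congr 1; simp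

include hw in
/-- **A `σ`-FIXED NON-NORM HAS ODD VALUATION AT AN INERT PLACE**: `π ∈ L ⊗ L⁺_v` with `(c ⊗ 1)π = π`, `π_w ≠ 0`, `π ≠ z̄ z` for all `z`
(the `hπN` of the literal package) has `ord_w(π_w)` odd — an even `σ_w`-fixed element is a norm (★ `exists_norm_solution_of_zpow_even` with the
inert dictionary of ★ Σ2-CM). [cite: Serre1979, Ch. V §2 Prop. 3] -/
theorem odd_log_valued_of_forall_conjLocal_mul_ne (hv : Algebra.IsUnramifiedIn (𝓞 L) v.asIdeal) {π : LocalRing L v}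
    (hσπ : conjLocal L (IsCMField.complexConj L) v π = π) (hπ0 : π w ≠ 0)
    (hπN : ∀ z : LocalRing L v, conjLocal L (IsCMField.complexConj L) v z * z ≠ π) :
    Odd (WithZero.log (Valued.v (π w))) := by
  classical
  haveI : Algebra.IsQuadraticExtension ↥(maximalRealSubfield L) L := IsCMField.isQuadraticExtension L
  have hc1 : IsCMField.complexConj L ≠ 1 := IsCMField.complexConj_ne_one L
  -- `π_w` is `σ_w`-fixed and not a norm
  have hσπw : galAdicCompletionMap (L := L) (IsCMField.complexConj L) hw (π w) = π w := by
    have h := congr_fun hσπ w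
    rwa [conjLocal_apply_eq_galAdicCompletionMap L v w hw] at h
  have hN : ∀ z : w.1.adicCompletion L, galAdicCompletionMap (L := L) (IsCMField.complexConj L) hw z * z ≠ π w := by
    intro z hz
    refine hπN (Function.update 0 w z) (funext fun w' => ?_)
    obtain rfl : w' = w := PlacesOver.eq_of_smul_eq (IsCMField.complexConj L) hc1 w hw w'
    rw [Pi.mul_apply, conjLocal_apply_eq_galAdicCompletionMap L v w' hw, Function.update_self]
    exact hz
  -- the inert dictionary at `w`
  have hσσ := galAdicCompletionMap_galAdicCompletionMap_of_smul_eq (IsCMField.complexConj L) w hc1 hw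
  have hσO := mem_integer_galAdicCompletionMap (IsCMField.complexConj L) v w hw
  have hmove := exists_isUnit_galAdicCompletionMap_sub (IsCMField.complexConj L) v hc1 hv w hw
  -- `ϖ := ι_w(ϖ_v)`
  have hϖv := valued_toPlace_uniformizer L v w hv
  have hϖ0 : toPlace v w (HeckeCharacter.uniformizer ↥(maximalRealSubfield L) v : v.adicCompletion ↥(maximalRealSubfield L)) ≠ 0 := by
    intro h; rw [h, map_zero] at hϖv; exact WithZero.zero_ne_coe hϖv
  have hσϖ := galAdicCompletionMap_toPlace_self L v w hw
    (HeckeCharacter.uniformizer ↥(maximalRealSubfield L) v : v.adicCompletion ↥(maximalRealSubfield L))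
  -- an even valuation would make `π_w` a norm
  rw [← Int.not_even_iff_odd]
  rintro ⟨k, hk⟩
  have hvπ0 : Valued.v (π w) ≠ 0 := (Valuation.ne_zero_iff _).2 hπ0
  have hx : Valued.v (π w) = WithZero.exp (-(2 * -k)) := by
    rw [← WithZero.exp_log hvπ0, hk]; congr 1; ring
  have hval := valuation_eq_valuation_zpow_of_valued_eq L w hϖv hx
  obtain ⟨a, ha⟩ := exists_norm_solution_of_zpow_even (galAdicCompletionMap (L := L) (IsCMField.complexConj L) hw) hσσ hσO hmove hϖ0 hσϖ
    hσπw (-k) hval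
  have ha0 : a ≠ 0 := by rintro rfl; rw [zero_mul, zero_mul] at ha; exact zero_ne_one ha
  refine hN a⁻¹ ?_
  rw [map_inv₀, ← mul_inv]
  have h' : galAdicCompletionMap (L := L) (IsCMField.complexConj L) hw a * a * π w = 1 := by
    rw [mul_comm (galAdicCompletionMap (L := L) (IsCMField.complexConj L) hw a) a]; exact ha
  exact (eq_inv_of_mul_eq_one_right h').symm

/-- **THE EXPLICIT EIGENFRAME `Q = Tl⁻¹ (D_π h)`** of `t` congruent to `t_π(x₁,x₂,x₃)`: `t · Q = Q · diag(x₁,x₂,x₃)` (the ★ frame of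
`exists_frame_of_congr_flickerTorusElt`, kept explicit for its Gram matrix). [cite: Flicker1998UnitaryFL, §2 Prop. 3 p. 78] -/
theorem exists_framePi_of_congr (H' : Matrix (Fin 3) (Fin 3) L) {e π π' x₁ x₂ x₃ : LocalRing L v} (h2e : 2 * e = 1) (hππ : π * π' = 1)
    (Tl : GL (Fin 3) (LocalRing L v))
    (ψ : ↥(UnitaryGroup.«local» L (IsCMField.complexConj L) 3 H' v) ≃ₜ*
        ↥(UnitaryGroup.«local» L (IsCMField.complexConj L) 3 (Matrix.of fun i j : Fin 3 => if i.val + j.val + 1 = 3 then (1 : L) else 0) v))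
    (t : (cmDatum L 3 H').Local v) (hψ : ∀ g, (ψ g).val = Tl * g.val * Tl⁻¹)
    (hlit : (ψ t).val.val = !![e * (x₁ + x₃), 0, -(e * (x₁ - x₃) * π); 0, x₂, 0; -(e * (x₁ - x₃) * π'), 0, e * (x₁ + x₃)]) :
    ∃ P₁ : GL (Fin 3) (LocalRing L v), P₁.val = !![π, 0, 0; 0, 1, 0; 0, 0, 1] * !![(1 : LocalRing L v), 0, 1; 0, 1, 0; -1, 0, 1] ∧
      (t.val.val : Matrix (Fin 3) (Fin 3) (LocalRing L v)) * (Tl⁻¹ * P₁).val = (Tl⁻¹ * P₁).val * diagonal ![x₁, x₂, x₃] := by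
  set P₁ : GL (Fin 3) (LocalRing L v) := ⟨_, _, Flicker1998.flickerFramePi_mul_inv h2e hππ, Flicker1998.flickerFramePiInv_mul h2e hππ⟩ with hP₁def
  have htval : (t.val.val : Matrix (Fin 3) (Fin 3) (LocalRing L v)) = Tl⁻¹.val * (ψ t).val.val * Tl.val := by
    rw [hψ t, Units.val_mul, Units.val_mul, ← Matrix.mul_assoc, ← Matrix.mul_assoc, ← Units.val_mul, inv_mul_cancel, Units.val_one, Matrix.one_mul,
      Matrix.mul_assoc, ← Units.val_mul, inv_mul_cancel, Units.val_one, Matrix.mul_one]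
  refine ⟨P₁, rfl, ?_⟩
  have hlit' : (ψ t).val.val = P₁.val * diagonal ![x₁, x₂, x₃] * (P₁⁻¹).val := by
    rw [hlit, Flicker1998.literal_pi_eq_conj_diagonal hππ, ← Flicker1998.diagonal_fin_three x₁ x₂ x₃]; rfl
  rw [htval, Units.val_mul, hlit', Matrix.mul_assoc, Matrix.mul_assoc, Matrix.mul_assoc, ← Matrix.mul_assoc Tl.val, ← Units.val_mul, mul_inv_cancel,
    Units.val_one, Matrix.one_mul, ← Units.val_mul P₁⁻¹, inv_mul_cancel, Units.val_one, Matrix.mul_one, ← Matrix.mul_assoc]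

omit [IsCMField L] in
/-- **THE GRAM MATRIX OF THE FRAME**: for the ISOMETRY `Tl` (`(σTl)ᵀ Φ₃ Tl = H′_v`) the frame `Q = Tl⁻¹ (D_π h)` has `(σQ)ᵀ H′_v Q = (σ(D_π h))ᵀ Φ₃ (D_π h)
= diag(−2π, 1, 2π)` (★ `gram_flickerFrame_pi`). [cite: Flicker1998UnitaryFL, §2 Prop. 3 p. 78] -/
theorem formCongr_framePi_eq (σ : LocalRing L v →+* LocalRing L v) {π : LocalRing L v} (hσπ : σ π = π) (Hv : Matrix (Fin 3) (Fin 3) (LocalRing L v))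
    (Tl P₁ : GL (Fin 3) (LocalRing L v))
    (hTl : formCongr σ Tl (Matrix.of fun i j : Fin 3 => if i.val + j.val + 1 = 3 then (1 : LocalRing L v) else 0) = Hv)
    (hP₁ : P₁.val = !![π, 0, 0; 0, 1, 0; 0, 0, 1] * !![(1 : LocalRing L v), 0, 1; 0, 1, 0; -1, 0, 1]) :
    formCongr σ (Tl⁻¹ * P₁) Hv = !![-2 * π, 0, 0; 0, 1, 0; 0, 0, 2 * π] := by
  rw [← hTl, formCongr_mul σ _ Tl⁻¹ P₁,
    ← formCongr_mul σ (Matrix.of fun i j : Fin 3 => if i.val + j.val + 1 = 3 then (1 : LocalRing L v) else 0) Tl Tl⁻¹, mul_inv_cancel,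
    UnitaryGroup.formCongr_one_eq]
  change ((P₁ : Matrix (Fin 3) (Fin 3) (LocalRing L v)).map σ)ᵀ * _ * (P₁ : Matrix (Fin 3) (Fin 3) (LocalRing L v)) = _
  rw [show (P₁ : Matrix (Fin 3) (Fin 3) (LocalRing L v)) = P₁.val from rfl, hP₁]
  exact Flicker1998.gram_flickerFrame_pi σ hσπ

/-- **THE EXPLICIT EIGENFRAME `Q = Tl⁻¹ h`** of `t` congruent to `t_1(x₁,x₂,x₃)`: `t · Q = Q · diag(x₁,x₂,x₃)` (★ `literal_one_eq_conj_diagonal`).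
[cite: Flicker1998UnitaryFL, §2 Prop. 3 p. 78] -/
theorem exists_frameOne_of_congr (H' : Matrix (Fin 3) (Fin 3) L) {e x₁ x₂ x₃ : LocalRing L v} (h2e : 2 * e = 1)
    (Tl : GL (Fin 3) (LocalRing L v))
    (ψ : ↥(UnitaryGroup.«local» L (IsCMField.complexConj L) 3 H' v) ≃ₜ*
        ↥(UnitaryGroup.«local» L (IsCMField.complexConj L) 3 (Matrix.of fun i j : Fin 3 => if i.val + j.val + 1 = 3 then (1 : L) else 0) v))
    (t : (cmDatum L 3 H').Local v) (hψ : ∀ g, (ψ g).val = Tl * g.val * Tl⁻¹)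
    (hlit : (ψ t).val.val = !![e * (x₁ + x₃), 0, -(e * (x₁ - x₃)); 0, x₂, 0; -(e * (x₁ - x₃)), 0, e * (x₁ + x₃)]) :
    ∃ P₁ : GL (Fin 3) (LocalRing L v), P₁.val = !![(1 : LocalRing L v), 0, 1; 0, 1, 0; -1, 0, 1] ∧
      (t.val.val : Matrix (Fin 3) (Fin 3) (LocalRing L v)) * (Tl⁻¹ * P₁).val = (Tl⁻¹ * P₁).val * diagonal ![x₁, x₂, x₃] := by
  set P₁ : GL (Fin 3) (LocalRing L v) := ⟨_, _, Flicker1998.flickerFrame_mul_inv h2e, Flicker1998.flickerFrameInv_mul h2e⟩ with hP₁def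
  have htval : (t.val.val : Matrix (Fin 3) (Fin 3) (LocalRing L v)) = Tl⁻¹.val * (ψ t).val.val * Tl.val := by
    rw [hψ t, Units.val_mul, Units.val_mul, ← Matrix.mul_assoc, ← Matrix.mul_assoc, ← Units.val_mul, inv_mul_cancel, Units.val_one, Matrix.one_mul,
      Matrix.mul_assoc, ← Units.val_mul, inv_mul_cancel, Units.val_one, Matrix.mul_one]
  refine ⟨P₁, rfl, ?_⟩
  have hlit' : (ψ t).val.val = P₁.val * diagonal ![x₁, x₂, x₃] * (P₁⁻¹).val := by
    rw [hlit, Flicker1998.literal_one_eq_conj_diagonal e x₁ x₂ x₃, ← Flicker1998.diagonal_fin_three x₁ x₂ x₃]; rfl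
  rw [htval, Units.val_mul, hlit', Matrix.mul_assoc, Matrix.mul_assoc, Matrix.mul_assoc, ← Matrix.mul_assoc Tl.val, ← Units.val_mul, mul_inv_cancel,
    Units.val_one, Matrix.one_mul, ← Units.val_mul P₁⁻¹, inv_mul_cancel, Units.val_one, Matrix.mul_one, ← Matrix.mul_assoc]

omit [IsCMField L] in
/-- **THE GRAM MATRIX OF THE FRAME `Tl⁻¹ h`** for the isometry `Tl`: `diag(−2, 1, 2)` (★ `gram_flickerFrame`). [cite: Flicker1998UnitaryFL, §1 p. 76] -/
theorem formCongr_frameOne_eq (σ : LocalRing L v →+* LocalRing L v) (Hv : Matrix (Fin 3) (Fin 3) (LocalRing L v))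
    (Tl P₁ : GL (Fin 3) (LocalRing L v))
    (hTl : formCongr σ Tl (Matrix.of fun i j : Fin 3 => if i.val + j.val + 1 = 3 then (1 : LocalRing L v) else 0) = Hv)
    (hP₁ : P₁.val = !![(1 : LocalRing L v), 0, 1; 0, 1, 0; -1, 0, 1]) :
    formCongr σ (Tl⁻¹ * P₁) Hv = !![-2, 0, 0; 0, 1, 0; 0, 0, 2] := by
  rw [← hTl, formCongr_mul σ _ Tl⁻¹ P₁,
    ← formCongr_mul σ (Matrix.of fun i j : Fin 3 => if i.val + j.val + 1 = 3 then (1 : LocalRing L v) else 0) Tl Tl⁻¹, mul_inv_cancel,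
    UnitaryGroup.formCongr_one_eq]
  change ((P₁ : Matrix (Fin 3) (Fin 3) (LocalRing L v)).map σ)ᵀ * _ * (P₁ : Matrix (Fin 3) (Fin 3) (LocalRing L v)) = _
  rw [show (P₁ : Matrix (Fin 3) (Fin 3) (LocalRing L v)) = P₁.val from rfl, hP₁]
  exact Flicker1998.gram_flickerFrame σ

include hw in
/-- **`formCongr` read at `w`**: `((σ_v Q)ᵀ M Q)_w = (σ_w Q_w)ᵀ M_w Q_w`. [cite: PlatonovRapinchuk1994, §5.1] -/
theorem formCongr_map_evalRingHom (Q : GL (Fin 3) (LocalRing L v)) (M : Matrix (Fin 3) (Fin 3) (LocalRing L v)) :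
    (formCongr (conjLocal L (IsCMField.complexConj L) v) Q M).map (Pi.evalRingHom (fun w' : PlacesOver L v => w'.1.adicCompletion L) w) =
      formCongr (galAdicCompletionMap (L := L) (IsCMField.complexConj L) hw)
        (Matrix.GeneralLinearGroup.map (Pi.evalRingHom (fun w' : PlacesOver L v => w'.1.adicCompletion L) w) Q)
        (M.map (Pi.evalRingHom (fun w' : PlacesOver L v => w'.1.adicCompletion L) w)) := by
  have hQ : ((Matrix.GeneralLinearGroup.map (Pi.evalRingHom (fun w' : PlacesOver L v => w'.1.adicCompletion L) w) Q :
      GL (Fin 3) (w.1.adicCompletion L)) : Matrix (Fin 3) (Fin 3) (w.1.adicCompletion L)) =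
        (Q : Matrix (Fin 3) (Fin 3) (LocalRing L v)).map (Pi.evalRingHom (fun w' : PlacesOver L v => w'.1.adicCompletion L) w) := rfl
  simp only [formCongr, Matrix.map_mul, hQ, ← Matrix.transpose_map, Matrix.map_map]
  congr 3
  funext z
  exact conjLocal_apply_eq_galAdicCompletionMap L v w hw z

/-- **Odd powers of a uniformizer are not norm values**: `|b σ_w b| · |ϖ^{2k+1}| ≠ 1` (valuations in `2ℤ` vs `2ℤ+1`). [cite: Serre1979, Ch. V §2] -/
theorem valuation_mul_map_mul_valuation_zpow_odd_ne_one {ϖ : w.1.adicCompletion L} (hϖ : Valued.v ϖ = WithZero.exp (-1 : ℤ))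
    (b : w.1.adicCompletion L) (k : ℤ) :
    ValuativeRel.valuation (w.1.adicCompletion L) (b * galAdicCompletionMap (L := L) (IsCMField.complexConj L) hw b) *
        ValuativeRel.valuation (w.1.adicCompletion L) (ϖ ^ (2 * k + 1)) ≠ 1 := by
  intro h
  have hϖ0 : ϖ ≠ 0 := by intro h0; rw [h0, map_zero] at hϖ; exact WithZero.zero_ne_coe hϖ
  rw [← map_mul, ← v_eq_one_iff_valuation_eq_one, map_mul, map_mul, valued_galAdicCompletionMap, map_zpow₀, hϖ] at h
  rcases eq_or_ne b 0 with rfl | hb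
  · rw [map_zero, zero_mul, zero_mul] at h; exact zero_ne_one h
  · have hvb : Valued.v b ≠ 0 := (Valuation.ne_zero_iff _).2 hb
    rw [← WithZero.exp_log hvb, ← WithZero.exp_add, ← WithZero.exp_zsmul, ← WithZero.exp_add, WithZero.exp_eq_one] at h
    simp only [smul_eq_mul] at h
    omega

omit [IsCMField L] in
/-- Differences of deep units have positive order: `|x − y| = exp(−Q)` with `|x − 1|, |y − 1| < 1` forces `1 ≤ Q`. [cite: Serre1979, Ch. II §1] -/
theorem one_le_of_valued_sub_eq_exp {x y : w.1.adicCompletion L} (hx : Valued.v (x - 1) < 1) (hy : Valued.v (y - 1) < 1) {Q : ℕ}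
    (hQ : Valued.v (x - y) = WithZero.exp (-(Q : ℤ))) : 1 ≤ Q := by
  have hlt : Valued.v (x - y) < 1 := by
    have e : x - y = (x - 1) - (y - 1) := by ring
    rw [e]
    exact lt_of_le_of_lt (Valuation.map_sub _ _ _) (max_lt hx hy)
  rw [hQ, ← WithZero.exp_zero, WithZero.exp_lt_exp] at hlt
  omega

end PlacePlumbing

end Literature.NumberTheory.Rogawski1990

end
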